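import Literature.Algebra.Homology.DiscreteRepModPairingLayers
import HarnessLib

/-!
# Milne's (b) through a COFINAL family of layers: `α¹(Δ, ℤ/m)` is bijective as soon as the layer identities hold on a
# cofinal family of open normal subgroups (Milne ADT I Lemma 1.7 / Thm. 1.8 (b); Serre CG I §2.2 Prop. 8)

Topic `Algebra/Homology`; namespace `Literature.Algebra.Homology.DiscreteRep`.  Sequel to door-c4 g16's
`DiscreteRepModPairingLayers.lean` (`layerPairingValue`, `inflTriv`, `adjointInjective/Surjective_triv_zmod_of_layers`).
Theorems only (no definition, no named fact, no instance, no notation, no `sorry`).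

THE POINT.  The criteria of `DiscreteRepModPairingLayers` quantify over ALL open normal `V ≤ Δ`; the arithmetic (door-c6's
cup products `inv_{E/L}(ι[x] ∪ β_m χ)`) is available at the TRACE layers `V = U_E ∩ U` of the finite Galois layers
`E ⊇ L` only.  Since every class of `Extⁿ_{C_Δ}(k, Y)` inflated from a layer `V` is also inflated from every smaller layer
`W ≤ V` (`LayerColimit.inflG_stepG`), a cofinal family `W : ι → OpenNormalSubgroup Δ` suffices:

* `LayerColimit.exists_inflG_eq_of_cofinal`, `LayerColimit.exists_inflTriv_eq_of_cofinal` — every class is inflated from a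
  member of the family;
* `adjointInjective_triv_zmod_of_cofinal`, `adjointSurjective_triv_zmod_of_cofinal`, `adjointBijective_triv_zmod_of_cofinal`
  — Milne's (b) from the layer identities ON THE FAMILY.

HONEST FRAMING: bookkeeping (cofinality) over door-c4's colimit theorem (d); no arithmetic.  Route A (A5)-ARITH of crux
`AnticycControlAdditiveK` (item 19295, cell bsd-schneider), seat door-c4 gen 16.

## References
* J. S. Milne, *Arithmetic Duality Theorems* (2nd ed. 2006), I §1 Lemma 1.7, Theorem 1.8 (b). [MilneADT2006]
* J.-P. Serre, *Galois Cohomology* (1997), I §2.2 Proposition 8. [SerreGaloisCohomology1997]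
-/

noncomputable section

open CategoryTheory CategoryTheory.Abelian groupCohomology

namespace Literature.Algebra.Homology

namespace DiscreteRep


variable {Δ : Type} [Group Δ] [TopologicalSpace Δ] [IsTopologicalGroup Δ]

/-! ## §1 Every class is inflated from a member of a cofinal family of layers -/

namespace LayerColimit

variable {k : Type} [CommRing k] [CompactSpace Δ] [TotallyDisconnectedSpace Δ] {ι : Type} (W : ι → OpenNormalSubgroup Δ)
  (hW : ∀ V : OpenNormalSubgroup Δ, ∃ i, (W i : Subgroup Δ) ≤ V)

include hW in
/-- **Every class of `Extⁿ_{C_Δ}(k, M)` is inflated from a member of a cofinal family of layers** (`exists_inflG_eq` and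
`inflG_stepG`). [cite: SerreGaloisCohomology1997, I §2.2 Proposition 8] -/
theorem exists_inflG_eq_of_cofinal (n : ℕ) (M : DiscreteRepCat k Δ) (x : Ext (triv (Γ := Δ) k) M n) :
    ∃ (i : ι) (c : groupCohomology ((invariantsQuotFunctor k (W i : Subgroup Δ)).obj M) n), inflG (W i) M n c = x := by
  obtain ⟨V, c, rfl⟩ := exists_inflG_eq n M x
  obtain ⟨i, hi⟩ := hW V
  exact ⟨i, stepG V (W i) hi M n c, inflG_stepG V (W i) hi M n c⟩

include hW in
/-- **Every class of `Extⁿ_{C_Δ}(k, Y)` (`Y` trivial) is `inflTriv` of a class between trivial modules of a member of a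
cofinal family of layers.** [cite: SerreGaloisCohomology1997, I §2.2 Proposition 8] -/
theorem exists_inflTriv_eq_of_cofinal (Y : Type) [AddCommGroup Y] [Module k Y] (n : ℕ)
    (y : Ext (triv (k := k) (Γ := Δ) k) (triv (k := k) (Γ := Δ) Y) n) :
    ∃ (i : ι) (y₁ : Ext (Rep.trivial k (Δ ⧸ (W i : Subgroup Δ)) k) (Rep.trivial k (Δ ⧸ (W i : Subgroup Δ)) Y) n),
      inflTriv (W i : Subgroup Δ) (coe_isOpen (W i)) y₁ = y := by
  obtain ⟨i, c, rfl⟩ := exists_inflG_eq_of_cofinal W hW n (triv (k := k) (Γ := Δ) Y) y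
  refine ⟨i, ((layerE (W i) (triv (k := k) (Γ := Δ) Y) n).symm c).comp
    (Ext.mk₀ (trivLayerHom (k := k) (W i : Subgroup Δ) Y)) (add_zero n), ?_⟩
  rw [inflG_apply]
  exact (extInf_triv_eq_inflTriv (W i : Subgroup Δ) (coe_isOpen (W i)) Y _).symm

end LayerColimit

/-! ## §2 Milne's (b) from the layer identities on a cofinal family -/

section Criteria

variable [CompactSpace Δ] [TotallyDisconnectedSpace Δ] (C : DiscreteRepCat ℤ Δ) {Q : Type} [AddCommGroup Q]
  (inv : Ext (triv (k := ℤ) (Γ := Δ) ℤ) C 2 →+ Q) {m : ℕ} (hm : 0 < m)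
  (h1 : ∀ x : Ext (triv (k := ℤ) (Γ := Δ) ℤ) C 1, x = 0)
  {ι : Type} (W : ι → OpenNormalSubgroup Δ) (hW : ∀ V : OpenNormalSubgroup Δ, ∃ i, (W i : Subgroup Δ) ≤ V)

omit [CompactSpace Δ] [TotallyDisconnectedSpace Δ] in
include h1 in
/-- **Milne's (b), injectivity, from a family of layers**: if every invariant vector `φ : ℤ → C` pairing to zero with the
characters of the layers `W i` is divisible by `m`, then `α¹(Δ, ℤ/m)` is injective (given `Ext¹_Δ(ℤ, C) = 0`).
[cite: MilneADT2006, I Lemma 1.7, Theorem 1.8 (b)] -/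
theorem adjointInjective_triv_zmod_of_cofinal
    (H : ∀ φ : triv (k := ℤ) (Γ := Δ) ℤ ⟶ C,
      (∀ (i : ι) (χ : groupCohomology (Rep.trivial ℤ (Δ ⧸ (W i : Subgroup Δ)) (ZMod m)) 1),
        layerPairingValue C inv hm (W i) φ χ = 0) →
      ∃ φ₂ : triv (k := ℤ) (Γ := Δ) ℤ ⟶ C, m • φ₂ = φ) :
    ExtDuality.AdjointInjective inv (triv (k := ℤ) (Γ := Δ) (ZMod m)) (show 1 + 1 = 2 from rfl) :=
  adjointInjective_triv_zmod_of_layers C inv hm h1 fun φ hφ => H φ fun i χ => hφ (W i) χ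

include h1 hW in
/-- **Milne's (b), surjectivity, from a cofinal family of layers**: if every additive functional `Φ` on
`Ext¹_{C_Δ}(ℤ, ℤ/m)` is represented by an invariant vector `φ : ℤ → C` on the inflated characters of the layers `W i`
(`Φ (inflTriv (W i) (E⁻¹ χ)) = inv (Inf (H²(id, φ) (β_m χ)))`), then `α¹(Δ, ℤ/m)` is surjective (given `Ext¹_Δ(ℤ, C) = 0`).
[cite: MilneADT2006, I Lemma 1.7, Theorem 1.8 (b)] -/
theorem adjointSurjective_triv_zmod_of_cofinal
    (H : ∀ Φ : Ext (triv (k := ℤ) (Γ := Δ) ℤ) (triv (k := ℤ) (Γ := Δ) (ZMod m)) 1 →+ Q,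
      ∃ φ : triv (k := ℤ) (Γ := Δ) ℤ ⟶ C,
        ∀ (i : ι) (χ : groupCohomology (Rep.trivial ℤ (Δ ⧸ (W i : Subgroup Δ)) (ZMod m)) 1),
          Φ (inflTriv (W i : Subgroup Δ) (LayerColimit.coe_isOpen (W i))
              ((RepExt.extTrivialAddEquivGroupCohomology (Rep.trivial ℤ (Δ ⧸ (W i : Subgroup Δ)) (ZMod m)) 1).symm χ)) =
            layerPairingValue C inv hm (W i) φ χ) :
    ExtDuality.AdjointSurjective inv (triv (k := ℤ) (Γ := Δ) (ZMod m)) (show 1 + 1 = 2 from rfl) := by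
  haveI : NeZero m := ⟨hm.ne'⟩
  refine (ExtDuality.adjointSurjective_X₃_iff inv (zmodSC_shortExact (Δ := Δ) m hm) h1).2 fun Φ => ?_
  obtain ⟨φ, hφ⟩ := H Φ
  refine ⟨Ext.mk₀ φ, fun y => ?_⟩
  obtain ⟨i, y₁, rfl⟩ := LayerColimit.exists_inflTriv_eq_of_cofinal (k := ℤ) W hW (ZMod m) 1 y
  have hy := hφ i (RepExt.extTrivialAddEquivGroupCohomology (Rep.trivial ℤ (Δ ⧸ (W i : Subgroup Δ)) (ZMod m)) 1 y₁)
  rw [AddEquiv.symm_apply_apply] at hy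
  rw [hy, ← inv_comp_extClass_comp_mk₀ C inv hm (W i) φ, AddEquiv.symm_apply_apply]
  rfl

include h1 hW in
/-- **Milne's (b) from a cofinal family of layers** — the shape of `TateDualityHypotheses.adjointBijective_one_zmod` for
`(U, Res_U C)` read at the trace layers of the finite Galois layers. [cite: MilneADT2006, I Theorem 1.8 (b)] -/
theorem adjointBijective_triv_zmod_of_cofinal
    (Hinj : ∀ φ : triv (k := ℤ) (Γ := Δ) ℤ ⟶ C,
      (∀ (i : ι) (χ : groupCohomology (Rep.trivial ℤ (Δ ⧸ (W i : Subgroup Δ)) (ZMod m)) 1),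
        layerPairingValue C inv hm (W i) φ χ = 0) →
      ∃ φ₂ : triv (k := ℤ) (Γ := Δ) ℤ ⟶ C, m • φ₂ = φ)
    (Hsurj : ∀ Φ : Ext (triv (k := ℤ) (Γ := Δ) ℤ) (triv (k := ℤ) (Γ := Δ) (ZMod m)) 1 →+ Q,
      ∃ φ : triv (k := ℤ) (Γ := Δ) ℤ ⟶ C,
        ∀ (i : ι) (χ : groupCohomology (Rep.trivial ℤ (Δ ⧸ (W i : Subgroup Δ)) (ZMod m)) 1),
          Φ (inflTriv (W i : Subgroup Δ) (LayerColimit.coe_isOpen (W i))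
              ((RepExt.extTrivialAddEquivGroupCohomology (Rep.trivial ℤ (Δ ⧸ (W i : Subgroup Δ)) (ZMod m)) 1).symm χ)) =
            layerPairingValue C inv hm (W i) φ χ) :
    ExtDuality.AdjointBijective inv (triv (k := ℤ) (Γ := Δ) (ZMod m)) (show 1 + 1 = 2 from rfl) :=
  ⟨adjointInjective_triv_zmod_of_cofinal C inv hm h1 W Hinj, adjointSurjective_triv_zmod_of_cofinal C inv hm h1 W hW Hsurj⟩

end Criteria

end DiscreteRep

end Literature.Algebra.Homology

end
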